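import Literature.MathematicalPhysics.QuantumFieldTheory.Balaban1983to89.B7Prop4Flat
import Literature.MathematicalPhysics.QuantumFieldTheory.Balaban1983to89.T4TermwiseTorus

/-!
# Spine/NE7/QLaFlatAveragingShift — TRANSLATION EQUIVARIANCE and PERIODICITY of the B7 fold's concrete averaging maps on `ℤ^d`
# ((42) `bavg`, (110) `Favg`∕`vframe`, (89) `dbavg`, the iterates (90)–(91) `dbavgIter` and (127) `logIter`): obligation (O2)(a) of
# the dictionary half (b) of NE7's R39 bridge (`pub-balaban-gaps-ne7/g5/HALF-B-SCOPE.md`)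

Cell `pub-balaban-gaps` (YM blitz Y1, track G2, seat `ne7`, generation 5); text of record
`run/shared/lean/pub/pub-balaban-gaps/ne/NE7.md` v5 §4sexies ∕ §8 0septies.  Fifteenth `Spine/NE7/` file.

WHY.  Files 11∕13∕14 prove NODE S's per-coarse-bond input for Bałaban's CONCRETE `k`-fold averaging on `ℤ^d` (B7 fold, corner
blocks).  The T⁴ chain consumes it through a torus `Setup.Averaging P j G` (sites `Fin d → ZMod n_j`).  The cheapest dictionary
(HALF-B-SCOPE (O2)) lifts a torus configuration to the PERIODIC configuration on `ℤ^d`, averages there, and reads back — which needs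
exactly two structural facts about the `ℤ^d` maps, both [folklore] and both absent from the tree as lemmas: (1) TRANSLATION
EQUIVARIANCE — shifting the fine configuration by `L^j·w` shifts the `j`-fold average by `w` (every B7 object is «base point + lattice
word», [Balaban1985Averaging] (9) p. 18, (42) p. 23, (89) p. 31, so this is an induction on words and levels), and (2) its
corollary PERIODICITY — an `N·L^k`-periodic fine configuration has an `N`-periodic `k`-fold average, so the average DESCENDS to the
torus `(ℤ/N)^d` at the coarse level.  For the ONE-STEP PLAIN average (42) both facts are ALREADY in the tree (`T4TermwiseTorus`,
lineage t4-ne7-p1 gen 12: `hol_shift`, `Wcx_shift`, `Xavg_shift`, `bavg_shift`, `IsPeriodic`, `IsPeriodic.bavg`∕`.bavg_coarse` —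
REUSED BY NAME here, found by the gate's dedup on this file's v1); THIS FILE adds the frames (110) `Favg`∕`vframe`, the double-bar
average (89) `dbavg`, and — the point — the ITERATES across scales: `dbavgIter_shift`∕`logIter_shift` (a shift by `L^j·w` below is
a shift by `w` at level `j`) and the descent `isPeriodic_logIter`∕`isPeriodic_dbavgIter` (period `n·L^k` below ⟹ period `n` at
level `k`), in `T4TermwiseTorus`'s `IsPeriodic` vocabulary.  No smallness, no analysis: identities of the concrete definitions.

HONEST FRAMING.  Structural identities of the B7 fold's concrete objects on `ℤ^d` (b07's definitions `B7Prop1Explicit.hol`∕`bavg`,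
`B7Prop3Flat.Favg`∕`vframe`∕`dbavg`, `B7Prop4Flat.dbavgIter`∕`logIter`); nothing of Bałaban's asserted; the torus instance itself
((O1), (O2)(b)(c) of HALF-B-SCOPE) is NOT built here.  NE7 NOT proved; spine 0∕9; fixed finite T⁴ — NOT ℝ⁴, NOT infinite volume,
NOT a mass gap, NOT Clay.
-/

noncomputable section

open scoped BigOperators
open Finset

namespace Summit.QuantumFields.BalabanUV.T4Continuum.Spine.NE7.B7Flat

open Literature.MathematicalPhysics.QuantumFieldTheory.Balaban1983to89.B7Prop1Explicit
open Literature.MathematicalPhysics.QuantumFieldTheory.Balaban1983to89.B7Prop2Explicit (rescale rescale_apply)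
open Literature.MathematicalPhysics.QuantumFieldTheory.Balaban1983to89.B7Prop3Flat
open Literature.MathematicalPhysics.QuantumFieldTheory.Balaban1983to89.B7Prop4Flat
open Literature.MathematicalPhysics.QuantumFieldTheory.Balaban1983to89.T4TermwiseTorus (hol_shift Wcx_shift Xavg_shift
  bavg_shift IsPeriodic)

variable {d : ℕ}

/-! ## §1 (Parallel transport (9) and the plain average (42): `T4TermwiseTorus.hol_shift` ∕ `Wcx_shift` ∕ `Xavg_shift` ∕ `bavg_shift`, REUSED.) -/

/-! ## §2 The one-step averages (42), (110), (89) are translation equivariant -/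

section OneStep

variable {𝔸 : Type*} [NormedRing 𝔸] [NormedAlgebra ℂ 𝔸] [CompleteSpace 𝔸]
variable (L : ℕ)

omit [CompleteSpace 𝔸] in
/-- (110) at `V₀ = 1`, the frame exponent `F(y)`: equivariant. [cite: Balaban1985Averaging, (110) p.34] -/
theorem Favg_shift (V : Site d → Fin d → 𝔸ˣ) (w q : Site d) :
    Favg L (fun y ν => V (y + w) ν) q = Favg L V (q + w) := by
  simp only [Favg, hol_shift]

/-- (110), the block frame `v(y)`: equivariant. [cite: Balaban1985Averaging, (110) p.34, (82) p.30] -/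
theorem vframe_shift (V : Site d → Fin d → 𝔸ˣ) (w q : Site d) :
    vframe L (fun y ν => V (y + w) ν) q = vframe L V (q + w) := by
  simp only [vframe, Favg_shift]

/-- **The double-bar average (89) is translation equivariant**: `V̿[V(· + w)](c) = V̿[V](c + w)`.
[cite: Balaban1985Averaging, (89)–(90) p.31] -/
theorem dbavg_shift (V : Site d → Fin d → 𝔸ˣ) (w : Site d) :
    dbavg L (fun y ν => V (y + w) ν) = fun q κ => dbavg L V (q + w) κ := by
  funext q κ
  simp only [dbavg, vframe_shift, bavg_shift, add_right_comm]

/-- (109): exponentiating bondwise commutes with shifts. [folklore] -/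
theorem expCfg_shift (B : Site d → Fin d → 𝔸) (w : Site d) :
    expCfg (fun y ν => B (y + w) ν) = fun q κ => expCfg B (q + w) κ := rfl

end OneStep

/-! ## §3 The iterates (90)–(91), (127): a shift by `L^j·w` below is a shift by `w` at level `j` -/

section Iterates

variable {𝔸 : Type*} [NormedRing 𝔸] [NormedAlgebra ℂ 𝔸] [CompleteSpace 𝔸]
variable (L : ℕ)

omit [NormedRing 𝔸] [NormedAlgebra ℂ 𝔸] [CompleteSpace 𝔸] in
/-- Scalar bookkeeping on `ℤ^d`: `L^{j+1}·w = L^j·(L·w)`. [folklore] -/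
private theorem pow_succ_smul (j : ℕ) (w : Site d) :
    ((L : ℤ) ^ (j + 1)) • w = ((L : ℤ) ^ j) • ((L : ℤ) • w) := by
  rw [pow_succ, mul_smul]

/-- **The `j`-fold double-bar iterate (90)–(91) is translation equivariant across scales**: shifting the unit-lattice
configuration by `L^j·w` shifts `U̿^j` (read on the unit lattice after `j` rescalings) by `w`.
[cite: Balaban1985Averaging, (90)–(91) p.31, (127) p.37] -/
theorem dbavgIter_shift (V : Site d → Fin d → 𝔸ˣ) :
    ∀ (j : ℕ) (w : Site d), dbavgIter L (fun y ν => V (y + ((L : ℤ) ^ j) • w) ν) j = fun z κ => dbavgIter L V j (z + w) κ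
  | 0, w => by funext z κ; simp
  | j + 1, w => by
    funext z κ
    rw [dbavgIter_succ, pow_succ_smul, dbavgIter_shift V j ((L : ℤ) • w), dbavg_shift, dbavgIter_succ, smul_add]

/-- **The composite `Q_j(1, ·)` (127) is translation equivariant across scales**: `Q_j(1, B(· + L^j w))(c) = Q_j(1, B)(c + w)`.
[cite: Balaban1985Averaging, (127) p.37] -/
theorem logIter_shift (B : Site d → Fin d → 𝔸) :
    ∀ (j : ℕ) (w : Site d), logIter L (fun y ν => B (y + ((L : ℤ) ^ j) • w) ν) j = fun z κ => logIter L B j (z + w) κ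
  | 0, w => by funext z κ; simp
  | j + 1, w => by
    funext z κ
    rw [logIter_succ, pow_succ_smul, logIter_shift B j ((L : ℤ) • w), expCfg_shift, dbavg_shift, logIter_succ, smul_add]

/-! ## §4 Periodicity: an `N·L^k`-periodic fine configuration has an `N`-periodic `k`-fold average (descent to the torus) -/

/-- **PERIODICITY OF `Q_k(1, ·)`**: if the unit-lattice field `B` is invariant under the shift by `L^k·p` (`p ∈ ℤ^d`, e.g.
`p = N·e_i` for a torus of `N` coarse sites per direction), then `Q_k(1, B)` is invariant under the shift by `p` — the `k`-fold
average of a configuration lifted from the torus `(ℤ/(N·L^k))^d` descends to the coarse torus `(ℤ/N)^d`. [folklore] -/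
theorem logIter_periodic (B : Site d → Fin d → 𝔸) (k : ℕ) (p : Site d)
    (hper : ∀ y ν, B (y + ((L : ℤ) ^ k) • p) ν = B y ν) (z : Site d) (κ : Fin d) :
    logIter L B k (z + p) κ = logIter L B k z κ := by
  have h := logIter_shift L B k p
  have hB : (fun y ν => B (y + ((L : ℤ) ^ k) • p) ν) = B := funext₂ hper
  rw [hB] at h
  exact (congrFun (congrFun h z) κ).symm

/-- **PERIODICITY OF `U̿^k`**: the same for the group-valued iterate (90)–(91). [folklore] -/
theorem dbavgIter_periodic (V : Site d → Fin d → 𝔸ˣ) (k : ℕ) (p : Site d)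
    (hper : ∀ y ν, V (y + ((L : ℤ) ^ k) • p) ν = V y ν) (z : Site d) (κ : Fin d) :
    dbavgIter L V k (z + p) κ = dbavgIter L V k z κ := by
  have h := dbavgIter_shift L V k p
  have hV : (fun y ν => V (y + ((L : ℤ) ^ k) • p) ν) = V := funext₂ hper
  rw [hV] at h
  exact (congrFun (congrFun h z) κ).symm

/-- Iterated periodicity: invariance under every integer multiple of the period (the form the torus read-back uses: two lifts of
the same torus point differ by an integer combination of the periods). [folklore] -/
theorem logIter_periodic_zsmul (B : Site d → Fin d → 𝔸) (k : ℕ) (p : Site d)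
    (hper : ∀ y ν, B (y + ((L : ℤ) ^ k) • p) ν = B y ν) (n : ℤ) (z : Site d) (κ : Fin d) :
    logIter L B k (z + n • p) κ = logIter L B k z κ := by
  -- invariance under `p` and `−p`, then induction on `n`
  have hfwd : ∀ z', logIter L B k (z' + p) κ = logIter L B k z' κ := fun z' => logIter_periodic L B k p hper z' κ
  have hbwd : ∀ z', logIter L B k (z' - p) κ = logIter L B k z' κ := fun z' => by
    have h' := hfwd (z' - p)
    rw [sub_add_cancel] at h'
    exact h'.symm
  induction n using Int.induction_on generalizing z with
  | zero => simp
  | succ n ih => rw [add_smul, one_smul, ← add_assoc, hfwd, ih]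
  | pred n ih => rw [sub_smul, one_smul, ← add_sub_assoc, hbwd, ih]

/-- **DESCENT OF THE `k`-FOLD AVERAGE TO THE COARSE TORUS** (in `T4TermwiseTorus`'s vocabulary): an `(n·L^k)`-periodic
unit-lattice field `B` — a field on the torus of `n·L^k` sites per direction read on the universal cover — has an `n`-periodic
`Q_k(1, B)`: the composite (127) is a map from the fine torus to the coarse torus of `n` sites per direction (the one-step,
plain-average case is `T4TermwiseTorus.IsPeriodic.bavg_coarse`). [cite: Balaban1987RG1, (0.1) p.251] -/
theorem isPeriodic_logIter (B : Site d → Fin d → 𝔸) (k n : ℕ) (hB : IsPeriodic (n * L ^ k) B) :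
    IsPeriodic n (logIter L B k) := fun z m => by
  funext κ
  refine logIter_periodic L B k ((n : ℤ) • m) (fun y ν => ?_) z κ
  have h := hB y m
  have hc : ((L : ℤ) ^ k) • ((n : ℤ) • m) = ((n * L ^ k : ℕ) : ℤ) • m := by
    rw [smul_smul]; congr 1; push_cast; ring
  rw [hc]
  exact congrFun h ν

/-- The same descent for the group-valued iterate `U̿^k` (90)–(91). [cite: Balaban1987RG1, (0.1) p.251] -/
theorem isPeriodic_dbavgIter (V : Site d → Fin d → 𝔸ˣ) (k n : ℕ) (hV : IsPeriodic (n * L ^ k) V) :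
    IsPeriodic n (dbavgIter L V k) := fun z m => by
  funext κ
  refine dbavgIter_periodic L V k ((n : ℤ) • m) (fun y ν => ?_) z κ
  have h := hV y m
  have hc : ((L : ℤ) ^ k) • ((n : ℤ) • m) = ((n * L ^ k : ℕ) : ℤ) • m := by
    rw [smul_smul]; congr 1; push_cast; ring
  rw [hc]
  exact congrFun h ν

end Iterates

end Summit.QuantumFields.BalabanUV.T4Continuum.Spine.NE7.B7Flat

end
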